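import Summits.AtomisticToContinuum.FouriersLaw.Theorems.BondHeatUncertaintyExtensiveSnapshotIrreversibilityEnergyWindowDilationArrivalA
import Summits.AtomisticToContinuum.FouriersLaw.Theorems.BondHeatUncertaintyExtensiveSnapshotIrreversibilityEnergyWindowDilationDeparture
import Summits.AtomisticToContinuum.FouriersLaw.Theorems.BondHeatUncertaintyExtensiveSnapshotIrreversibilityEnergyWindowWeightMomentsCoord

/-!
(SPLIT FOR THE 400-LINE CAP by the landing lane, hand-2 g33: this file = part 1 of 2; sequels `…BondHeatUncertaintyExtensiveSnapshotIrreversibilityEnergyWindowDilationArrival` import it in a chain; same namespace, all FQNs unchanged.)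
# Bond heat uncertainty — node «DilationArrival» (part X-2): the ARRIVAL side of the dilation
  Duhamel — (EBᵃ) and (XBᶠ) from the ORDER-1 ARRIVAL score duals (momentum index `2` of (SD₁),
  position index `1` of (SD₁q)); the record beneath S3 becomes `(Dᵛ) ∧ (RW₁) ∧ (SD₁q)`

Cell `decomp-a2c`, lens «grading / quantitative ladder», generation 87 (critic row 1231 (4);
this part is X-2, after X-1 `…EnergyWindowDilationDeparture`).  Record beneath S3 after X-1
(`kernelTemperatureLipschitz_of_dilation_gram`):
`S3 ⟸ (Dᵛ) ∧ (EBᵃ) ∧ (RW₁) ∧ (SD₁q){0} ∧ (XBᶠ)`.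

## What is proved (no proof holes; toolbox in part X-2A `…EnergyWindowDilationArrivalA`)

* §1 ★ `dilationArrivalBound_of_scoreDual : DensityScoreDualBoundOn {2} → (EBᵃ)`.
  `∫ D_b h dP^δ_1(z,·) = ∫ p(1,z,y) y_{p_b} ∂_{p_b}h(y) dy = −∫ h p(1,z,·) − ∫ (h y_{p_b})
  ∂_{y_{p_b}}p(1,z,·)` (by parts, `h ∈ C_c^∞`, X-2A §4); the first term is `≤ e^{2γTθ} e^{θH(z)}`
  (CEHR (3.4)), the second is the momentum ARRIVAL dual (index `2`) with the smooth compactly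
  supported test function `G = h·p_b`, `|G| ≤ K e^{(θ+ε)H}`, `r = θ'/(θ+ε)`, `ε = (θ'−θ)/2`, and the
  CEHR root bound with constant (X-2A §3); rates `(θ+ε) + ε = θ'`.
* §1 ★ `exchangeTermBoundFar_of_scoreDuals :
    DensityScoreDualBoundOn {2} → DensityScoreDualBoundPositionOn {1} → (XBᶠ)`.
  For `s ∈ [½, 1]`, `u = P^δ_{1−s} h ∈ C^∞` (X-2A §2 — at `s = 1`, `u = h`), `|u| ≤ e^{2γTθ} e^{θH}`
  (CEHR); `𝒜_b u = p_b ∂_{q_b}u + (∂_{q_b}H) ∂_{p_b}u` is continuous.  If `𝒜_b u` is not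
  `P^δ_s(z,·)`-integrable the integral is `0` by convention; otherwise truncate with the scaled
  cutoff `χ_R` (`R = n+1`) and integrate by parts against `p(s,z,·)` (X-2A §4, the field being
  divergence-free):
  `∫ χ_R 𝒜_b u dP^δ_s(z,·) = −∫ u (p_b ∂_{q_b}χ_R + ∂_{q_b}H ∂_{p_b}χ_R) dP^δ_s(z,·)
   − ∫ (χ_R u p_b) ∂_{y_{q_b}}p(s,z,·) − ∫ (χ_R u ∂_{q_b}H) ∂_{y_{p_b}}p(s,z,·)`; the first term is
  `≤ A/R` (CEHR, `|∂χ_R| ≤ K/R`), the other two are the position (index `1`) and momentum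
  (index `2`) ARRIVAL duals with smooth compactly supported test functions bounded by
  `K e^{2γTθ} e^{(θ+ε)H}` UNIFORMLY in `R`; dominated convergence `χ_R 𝒜_b u → 𝒜_b u` gives
  `|∫ 𝒜_b u dP^δ_s(z,·)| ≤ M e^{θ'H(z)}` (the argument of `perturbedKernelHessianIBP_of_compact`).
* §2 junctions: ★★ `kernelTemperatureLipschitz_of_dilation_duals :
  (Dᵛ) → (SD₁) DensityScoreDualBoundFirst → (SD₁q) DensityScoreDualBoundPosition → S3`, and the
  ★★ RECORD JUNCTION `kernelTemperatureLipschitz_of_dilation_gram₂ :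
  (Dᵛ) → (RW₁) GramControlledWeightMoments → (SD₁q) → S3` ((SD₁) from the tree's
  `densityScoreDualBoundFirst_of_gram` with (MC∞) PROVED, `skeletonGramLimitInverseMoments_proved`);
  K_fix junctions `snapshotKLUpperExpansion_of_atoms₇DD` / `…₇DG`.
* §3 the same record over the prover seat's coordinate-generic target (RW₁ᶜ)
  `GramControlledWeightMomentsCoord` (addendum X-2C `…EnergyWindowWeightMomentsCoord`, critic
  row 1245 (2)): ★★ `kernelTemperatureLipschitz_of_dilation_coord : (Dᵛ) → (RW₁ᶜ) → (SD₁q) → S3`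
  and `snapshotKLUpperExpansion_of_atoms₇DC`.

Hence the record beneath S3 after this part:
`S3 ⟸ (Dᵛ)[INSTR·hands] ∧ (RW₁ᶜ)[prover seat; (RW₁ᶜ) ⟹ (RW₁)] ∧ (SD₁q)[named leaf]` — all four
bounds (EBᵃ), (EBᵈ), (XBⁿ), (XBᶠ) of part W are discharged by ORDER-1 score duals; no
second-order quantity and no orbit-regularity leaf ((R2^δ) of the g86 plan is the theorem
`contDiff_pertKernelFun`).
Only `theorem` declarations; no proof holes.  References: N. Cuneo, J.-P. Eckmann, M. Hairer,
L. Rey-Bellet, Electron. J. Probab. 23 (2018) no. 55, Prop. 3.2, §3 eq. (3.2)–(3.4); D. Nualart,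
*The Malliavin Calculus and Related Topics* (2006), Prop. 2.1.4; J.-M. Bismut, *Large deviations
and the Malliavin calculus* (1984); K. D. Elworthy, X.-M. Li, J. Funct. Anal. 125 (1994), Thm 2.1.
-/

noncomputable section

namespace Summit.AtomisticToContinuum.FouriersLaw.Theorems.ExtensiveSnapshotIrreversibility.EnergyWindow

open MeasureTheory Filter Topology Real Set Metric
open scoped ENNReal NNReal ContDiff
open Literature.MathematicalPhysics.KineticTheory.HeatConduction Literature.Probability.Process

variable {N : ℕ}

/-! ## 1. ★ The arrival side: (EBᵃ) and (XBᶠ) from the arrival duals -/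

/-- ★ **(SD₁) index `2` ⟹ (EBᵃ)**: the ARRIVAL dilation bound from the order-1 momentum
arrival score dual.  `∫ D_b h dP^δ_1(z,·) = −∫ h p(1,z,·) − ∫ (h p_b) ∂_{y_{p_b}}p(1,z,·)`
(by parts); CEHR (3.4) for the first term; the dual at `s = 1` with `G = h p_b`
(`|G| ≤ K e^{(θ+ε)H}`, `r = θ'/(θ+ε)`, `ε = (θ'−θ)/2`) and the CEHR root bound for the second.
[cite: CuneoEckmannHairerReyBellet2018, §3 eq. (3.4)] -/
theorem dilationArrivalBound_of_scoreDual (hSD : DensityScoreDualBoundOn {2}) :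
    DilationArrivalBound := by
  intro ω₂ lam β γ hω hl hβ hγ T hT N hN θ θ' hθ hθθ' hθ'1
  have hθ'0 : 0 < θ' := hθ.trans hθθ'
  have hgap : 0 < θ' - θ := sub_pos.2 hθθ'
  set ε : ℝ := (θ' - θ) / 2 with hε
  have hε0 : 0 < ε := by positivity
  set θ₁ : ℝ := θ + ε with hθ₁
  have hθ₁0 : 0 < θ₁ := by positivity
  have hθ₁θ' : θ₁ < θ' := by rw [hθ₁, hε]; linarith
  have hθ₁ε : θ₁ + ε = θ' := by rw [hθ₁, hε]; ring
  set r : ℝ := θ' / θ₁ with hr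
  have hr1 : 1 < r := (one_lt_div hθ₁0).2 hθ₁θ'
  have hrθ : r * θ₁ = θ' := by rw [hr]; field_simp
  obtain ⟨δ₁, C₁, hδ₁, hC₁, hW⟩ := hSD ω₂ lam β γ hω hl hβ hγ T hT N hN r ε hr1 hε0
  obtain ⟨K, hK0, hK⟩ := exists_bathCoeff_le_exp hω hl.le hβ.le hγ.le N hε0
  have hTθ : θ' * T < 1 := by rwa [lt_div_iff₀ hT] at hθ'1
  have hg : 0 < 1 / θ' - T := by rw [sub_pos, lt_div_iff₀ hθ'0]; linarith
  set P := pinnedChain ω₂ lam β γ with hPdef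
  set H := P.hamiltonian N with hH
  set E₀ : ℝ := Real.exp (θ * γ * (T + T)) with hE₀
  set E₁ : ℝ := Real.exp (θ₁ * γ * (T + T)) with hE₁
  refine ⟨min δ₁ (min T (1 / θ' - T)), E₀ + K * (E₁ * C₁), lt_min hδ₁ (lt_min hT hg),
    fun δ hδ h hhC hhc hhθ b hb z => ?_⟩
  have hδ₁' : |δ| < δ₁ := lt_of_lt_of_le hδ (min_le_left _ _)
  obtain ⟨hL, hR, hθmax⟩ :=
    twoTemperature_window hT hθ'0 hθ'1 (lt_of_lt_of_le hδ (min_le_right _ _))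
  have hN0 : 0 < N := by omega
  obtain ⟨p, hp⟩ := isTransitionDensity_exists hω hl.le hβ.le hγ hN0 hL hR.le
  have h2T : T + δ / 2 + (T - δ / 2) = T + T := by ring
  have hθmax₀ : θ < 1 / max (T + δ / 2) (T - δ / 2) := hθθ'.trans hθmax
  have hHz : 0 ≤ H z := pinnedChain_hamiltonian_nonneg hω.le hl.le hβ.le γ N z
  have hh1 : ContDiff ℝ 1 h := hhC.of_le (by exact_mod_cast le_top)
  -- the arrival density `f₀ = p(1,z,·)`
  set f₀ : PhaseSpace N → ℝ := p 1 z with hf₀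
  have hf₀C : ContDiff ℝ ∞ f₀ := hp.contDiff_right_top one_pos z
  have hf₀1 : ContDiff ℝ 1 f₀ := hf₀C.of_le (by exact_mod_cast le_top)
  have hconv : ∀ g : PhaseSpace N → ℝ,
      ∫ y, g y ∂(pertKernel ω₂ lam β γ T δ N 1 z) = ∫ y, f₀ y * g y := fun g => by
    simp only [pertKernel]
    rw [hp.kernel_eq one_pos z,
      integral_withDensity_ofReal_phaseSpace hf₀C.continuous.measurable (hp.2.1 1 one_pos z)]
  have e0 : dilationArrival ω₂ lam β γ T δ N b h z = ∫ y, f₀ y * momDilation b h y := hconv _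
  rw [e0, integral_mul_momDilation_eq b hh1 hhc hf₀1]
  -- term 1: CEHR (3.4)
  have t1 : |∫ y, h y * f₀ y| ≤ E₀ * Real.exp (θ * H z) := by
    have e : ∫ y, h y * f₀ y = ∫ y, h y ∂(pertKernel ω₂ lam β γ T δ N 1 z) := by
      rw [hconv]
      exact integral_congr_ae (ae_of_all _ fun y => mul_comm _ _)
    rw [e]
    obtain ⟨-, hb1⟩ := integrable_and_abs_integral_transitionKernel_le hω hl hβ hγ hN0 hL hR hθ
      hθmax₀ (1 : ℝ).toNNReal z zero_le_one hhC.continuous.measurable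
      (fun y => by rw [one_mul]; exact hhθ y)
    simp only [one_mul, Real.coe_toNNReal (1 : ℝ) zero_le_one, mul_one, h2T] at hb1
    exact hb1
  -- term 2: the momentum ARRIVAL dual (index 2) with `G = h p_b`
  have t2 : |∫ y, (h y * y.2 b) * partialP b f₀ y| ≤
      (K * (E₁ * Real.exp (θ₁ * H z))) * (C₁ * Real.exp (ε * H z)) := by
    have hGC : ContDiff ℝ ∞ fun y : PhaseSpace N => h y * y.2 b :=
      hhC.mul (contDiff_momentum_coord b)
    have hGc : HasCompactSupport fun y : PhaseSpace N => h y * y.2 b := hhc.mul_right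
    have hGb : ∀ y, |h y * y.2 b| ≤ K * Real.exp (θ₁ * H y) := fun y => by
      rw [abs_mul]
      calc |h y| * |y.2 b| ≤ Real.exp (θ * H y) * (K * Real.exp (ε * H y)) :=
            mul_le_mul (hhθ y) (hK b y).1 (abs_nonneg _) (Real.exp_pos _).le
        _ = K * Real.exp (θ₁ * H y) := by rw [hθ₁, add_mul, Real.exp_add]; ring
    have hd := hW δ hδ₁' p hp 1 (by norm_num) le_rfl b hb z _ hGC hGc 2 (Set.mem_singleton _)
    have hroot := rpow_integral_abs_rpow_mul_density_le_of_le_mul hω hl hβ hγ hN0 hL hR hθ₁0 hr1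
      (by rwa [hrθ]) hp one_pos le_rfl z hK0 hGb
    rw [h2T] at hroot
    have e1 : ∀ y, densityDeriv p 1 b z 2 y = partialP b f₀ y := fun y => rfl
    simp only [e1] at hd
    exact hd.trans (mul_le_mul_of_nonneg_right hroot (by positivity))
  have hE₀0 : 0 ≤ E₀ := (Real.exp_pos _).le
  calc |-(∫ y, h y * f₀ y) - ∫ y, (h y * y.2 b) * partialP b f₀ y|
      ≤ |-(∫ y, h y * f₀ y)| + |∫ y, (h y * y.2 b) * partialP b f₀ y| := abs_sub _ _
    _ ≤ E₀ * Real.exp (θ * H z) + (K * (E₁ * Real.exp (θ₁ * H z))) * (C₁ * Real.exp (ε * H z)) := by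
        rw [abs_neg]; exact add_le_add t1 t2
    _ ≤ E₀ * Real.exp (θ' * H z) +
          (K * (E₁ * Real.exp (θ₁ * H z))) * (C₁ * Real.exp (ε * H z)) :=
        add_le_add (mul_le_mul_of_nonneg_left
          (Real.exp_le_exp.2 (mul_le_mul_of_nonneg_right hθθ'.le hHz)) hE₀0) le_rfl
    _ = (E₀ + K * (E₁ * C₁)) * Real.exp (θ' * H z) := by
        rw [← hθ₁ε, add_mul θ₁ ε (H z), Real.exp_add]; ring

end Summit.AtomisticToContinuum.FouriersLaw.Theorems.ExtensiveSnapshotIrreversibility.EnergyWindow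

end
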